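/-
Copyright (c) 2026. All rights reserved.
Released under Apache 2.0 license as described in the file LICENSE.
Authors: abc-iut cell, prover seat abc-iut-W-row-2 (MINT-LIST W batch 2, gen 0).
-/
import Literature.IUT.LogVolume.UnitLogMaxNorm
import Literature.IUT.LogVolume.UnitLogVolume
import Literature.IUT.LogVolume.LogShellTopology
import HarnessLib

/-!
# The U2 cell, INHABITED side from bounds: shell-radius witnesses exist at every place; the unit ball is never inside
# `log_p(𝒪^×)`; the integer test `e·⌊(j²P − j·δ − (j+1)·R_in)/e⌋ + (j+1)·R_out ≤ P` from LOWER bounds only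

abc-iut cell, seat abc-iut-W-row-2 (D-0079 sub-cell R-W «WINDOW Θ-SIDE INEQUALITY», lane U / P+; director-abc MINT-LIST W batch 2,
«first WINDOW-row decision, INHABITED side», D-0107).  PROOF-ONLY file (no definitions, no named `Prop` facts): classical local lemmas
consumed by the Summits-side companion `Summits/ABC/IUTFork/Cor312LicenceWildInhabitedRealising.lean`, which turns abc-iut-w4-d036's
U2-LICENCE-WRAPPER (`licence_settingPrVolSharp_iff_shellRadii`, p460046) into an INHABITED verdict from per-place lower bounds.

WHY.  The wrapper decides the licence by ONE `∀ m`-predicate in the EXACT inner/outer radii of the factor log-shells (abc-iut-c312-5's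
binders `hin0/hin/hmax/hout0/houtΛ/hdom`), which at WILD places (`p ∣ e`, ties `(p−1) ∣ e`) have no closed form in the tree.  The
INHABITED direction is MONOTONE and needs only: (i) the binders are SATISFIABLE (so the wrapper applies at all); (ii) an UPPER bound
on the inner radius; (iii) a LOWER bound on the outer radius; (iv) a LOWER bound on the different.  This file PROVES, for every proper
ultrametric normed `ℚ_p`-algebra field `K` (any `p`, any ramification):

* §1 `not_closedBall_one_subset_logUnits` — the unit ball is never inside `log_p(𝒪^×)` (its volume is `p^{−(f+m)} < 1`, [IUTchIV]
  Prop. 1.4 (ii), abc-iut-S8/S2 `localVolume_real_logUnits_eq_inv_pow`); `norm_le_rpow_of_mul_subset_logUnits` — a principal ball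
  `c·𝒪 ⊆ log_p(𝒪^×)` has `‖c‖ ≤ p^{−R/e}` as soon as the ball of radius `p^{−(R−1)/e}` is NOT inside (`R = 1` always, by the first
  lemma); `rpow_envelope_le_norm_of_dominates` — off the cyclotomic indices the largest norm on `log_p(𝒪^×)` is `≥ p^{−(p^{a₀}−e·a₀)/e}`
  (abc-iut-c312-3's envelope is ATTAINED, `LogEnvelope.exists_mem_logUnits_norm_eq_envelope`); **`exists_shellRadii_witnesses`** —
  abc-iut-c312-5's six shell-radius binders are satisfiable at EVERY place (compactness of `log_p(𝒪^×)`, abc-iut-S1 `isCompact_logUnits`,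
  and the least admissible exponent of a ball inside it).
* §2 `cell_rhs_of_bounds` — the integer heart of the inhabited side: slots `I` (`|I| = j+1`), `ρ_in(a) ≤ p^{−R_in/e}`,
  `ρ_out(a) ≥ p^{−R_out/e}`, `d ≥ δ/e`; IF **`e·⌊(j²P − j·δ − (j+1)·R_in)/e⌋ + (j+1)·R_out ≤ P`** THEN
  `∀ m, p^m·p^{−j²P/e} ≤ p^{−j·d}·∏ρ_in → p^m·p^{−P/e} ≤ ∏ρ_out` — the right-hand side of the wrapper's cell with every exact radius replaced
  by the bound in the monotone direction (compare abc-iut-w5-d180's exact `TensorPacketLicenceCellOrders`, p459071, where the radii are exact).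

SANITY (numbers, not adjectives): at the R-W table's packet `(p, e, P) = (5, 16980, 660)` of the abc triple `283 + 5¹¹·13² = 2⁸·3⁸·17³` at
`l = 283` (HOME/plan/rescue/R-W/OPEN-10.md row 8) the test holds at every label `j ≤ 141` already with `δ := e − 1`, `R_in := 1`,
`R_out := 5⁶ − 6·16980 = −86255` (turning point `a₀ = 6`; minimal margin `190150` over the labels, desk check in the seat folder); the EXACT wild inner radius and different of the N2 numerics are not needed
there.  HONEST SCOPE: the (Ind2)/hull are the tree's typings of disputed-corpus constructions; the cell is a STRONGER-THAN-PRINT per-summand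
reading of [IUTchIII] Cor. 3.12 Step (xi-f); nothing here bears on the printed inequality; no side taken on Cor. 3.12 or on any author.
[cite: Mochizuki2012, IUTchIV Prop. 1.1 p. 9, Prop. 1.2 (i)(ii) p. 10, Prop. 1.4 (ii) p. 13] [cite: NeukirchANT1999, Ch. II (5.5)]
[cite: DupuyHilado2025, §3.4, §4.9, §4.12] [claim: Mochizuki2012, status: disputed] for the locutions `log_p(R^×)`, «hull», «(Ind2)» only.
-/

noncomputable section

open Set Metric MeasureTheory Function

/-! ## §1. Shell-radius witnesses exist everywhere; bounds that need no closed form -/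

namespace Literature.IUT.LogVolume

open Literature.NumberTheory.GaloisRepresentations.Ultrametric

section Local

variable (p : ℕ) [hp : Fact p.Prime]
variable {K : Type} [NontriviallyNormedField K] [instK : NormedAlgebra ℚ_[p] K] [IsUltrametricDist K] [ProperSpace K]

include instK in
/-- **The unit ball is never inside `log_p(𝒪^×)`**: `μ(log_p(𝒪^×)) = p^{−(f+m)} < 1 = μ(𝒪)` ([IUTchIV] Prop. 1.4 (ii), abc-iut-S8/S2
`localVolume_real_logUnits_eq_inv_pow`). Hence the inner radius of the log-unit lattice is `≤ p^{−1/e}` at EVERY place.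
[cite: Mochizuki2012, IUTchIV Prop. 1.4 (ii) p. 13] -/
theorem not_closedBall_one_subset_logUnits : ¬ closedBall (0 : K) 1 ⊆ logUnits K := by
  borelize K
  intro h
  have hmono : localVolume K (closedBall (0 : K) 1) ≤ localVolume K (logUnits K) := measure_mono h
  rw [localVolume_closedBall_one] at hmono
  have hfin : localVolume K (logUnits K) ≠ ⊤ := (isCompact_logUnits p K).measure_lt_top.ne
  have h1 : (1 : ℝ) ≤ (localVolume K (logUnits K)).toReal := by
    have := ENNReal.toReal_mono hfin hmono
    simpa using this
  rw [localVolume_real_logUnits_eq_inv_pow p K] at h1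
  have hp1 : (1 : ℝ) < p := by exact_mod_cast hp.out.one_lt
  have hf : 1 ≤ residueDegree p K + torsionPExp p K := le_add_right (residueDegree_pos p K)
  have hlt : ((p : ℝ) ^ (residueDegree p K + torsionPExp p K))⁻¹ < 1 := by
    apply inv_lt_one_of_one_lt₀
    exact one_lt_pow₀ hp1 (by omega)
  linarith

include instK in
/-- A principal ball `c·𝒪` inside `log_p(𝒪^×)` is the closed ball of radius `‖c‖`. [cite: NeukirchANT1999, Ch. II (5.5)] -/
theorem closedBall_subset_logUnits_of_mul (c : K) (hc : ∀ o : K, ‖o‖ ≤ 1 → c * o ∈ logUnits K) :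
    closedBall (0 : K) ‖c‖ ⊆ logUnits K := by
  intro z hz
  rw [mem_closedBall_zero_iff] at hz
  by_cases hc0 : c = 0
  · have hz0 : z = 0 := by
      rw [hc0, norm_zero] at hz
      exact norm_le_zero_iff.mp hz
    rw [hz0]
    exact zero_mem_logUnits (p := p)
  · have h := hc (z / c) (by
      rw [norm_div, div_le_one (norm_pos_iff.mpr hc0)]
      exact hz)
    rwa [mul_div_cancel₀ _ hc0] at h

include instK in
/-- **Inner radius from a non-containment.** If `c·𝒪 ⊆ log_p(𝒪^×)` and the closed ball of radius `p^{−(R−1)/e}` is NOT inside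
`log_p(𝒪^×)`, then `‖c‖ ≤ p^{−R/e}` (the value group of `K^×` is `p^{(1/e)ℤ}`, `RamificationInvariants.exists_norm_eq_rpow`).
[cite: NeukirchANT1999, Ch. II (5.5)] -/
theorem norm_le_rpow_of_mul_subset_logUnits {c : K} (hc : ∀ o : K, ‖o‖ ≤ 1 → c * o ∈ logUnits K) {R : ℤ}
    (hR : ¬ closedBall (0 : K) ((p : ℝ) ^ (-(((R : ℝ) - 1) / absRamificationIdx p K))) ⊆ logUnits K) :
    ‖c‖ ≤ (p : ℝ) ^ (-((R : ℝ) / absRamificationIdx p K)) := by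
  have hp1 : (1 : ℝ) < p := by exact_mod_cast hp.out.one_lt
  have he : (0 : ℝ) < absRamificationIdx p K := by exact_mod_cast absRamificationIdx_pos p K
  by_contra hlt
  rw [not_le] at hlt
  have hc0 : c ≠ 0 := by
    intro h0
    rw [h0, norm_zero] at hlt
    exact absurd hlt (not_lt.mpr (Real.rpow_nonneg (by positivity) _))
  obtain ⟨m, hm⟩ := exists_norm_eq_rpow p K hc0
  -- `m < R`, hence `m ≤ R − 1`, hence the forbidden ball lies in `c·𝒪`
  have hmR : m ≤ R - 1 := by
    rw [hm, Real.rpow_lt_rpow_left_iff hp1] at hlt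
    have h' : (m : ℝ) / absRamificationIdx p K < (R : ℝ) / absRamificationIdx p K := by linarith
    rw [div_lt_div_iff_of_pos_right he] at h'
    have : m < R := by exact_mod_cast h'
    omega
  apply hR
  intro z hz
  apply closedBall_subset_logUnits_of_mul p c hc
  rw [mem_closedBall_zero_iff] at hz ⊢
  refine hz.trans ?_
  rw [hm]
  apply Real.rpow_le_rpow_of_exponent_le hp1.le
  have : ((m : ℝ)) ≤ (R : ℝ) - 1 := by exact_mod_cast hmR
  have h3 : (m : ℝ) / absRamificationIdx p K ≤ ((R : ℝ) - 1) / absRamificationIdx p K :=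
    div_le_div_of_nonneg_right this he.le
  linarith

include instK in
/-- `‖ϖ‖^z = p^{−z/e}` for a norm uniformiser `ϖ` and `z ∈ ℤ`. [cite: NeukirchANT1999, Ch. II (5.5)] -/
theorem norm_isUniformizer_zpow_eq_rpow {ϖ : Kˣ} (hϖ : IsUniformizer ϖ) (z : ℤ) :
    ‖(ϖ : K)‖ ^ z = (p : ℝ) ^ (-((z : ℝ) / absRamificationIdx p K)) := by
  have hp0 : (0 : ℝ) ≤ p := by positivity
  rw [norm_eq_rpow_of_isUniformizer p K hϖ, ← Real.rpow_intCast, ← Real.rpow_mul hp0]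
  congr 1
  ring

include instK in
/-- **Outer radius from the envelope.** For a STRICT turning point `a₀` of `e = e(K/ℚ_p)` (`p^a·(p−1) < e` for `a < a₀`,
`e < p^{a₀}·(p−1)`: `e` is not a cyclotomic index) every `c_out` dominating `log_p(𝒪^×)` in norm has `p^{−(p^{a₀} − e·a₀)/e} ≤ ‖c_out‖` —
the envelope norm is ATTAINED by `log_p(1 + ϖ)` (abc-iut-c312-3 `LogEnvelope.exists_mem_logUnits_norm_eq_envelope`).
[cite: NeukirchANT1999, Ch. II (5.5)] -/
theorem rpow_envelope_le_norm_of_dominates {a₀ : ℕ}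
    (hlo : ∀ a < a₀, (p : ℤ) ^ a * ((p : ℤ) - 1) < absRamificationIdx p K)
    (hhi : (absRamificationIdx p K : ℤ) < (p : ℤ) ^ a₀ * ((p : ℤ) - 1))
    {cout : K} (hdom : ∀ z ∈ logUnits K, ‖z‖ ≤ ‖cout‖) :
    (p : ℝ) ^ (-((((p : ℤ) ^ a₀ - (absRamificationIdx p K : ℤ) * (a₀ : ℤ) : ℤ) : ℝ) / absRamificationIdx p K)) ≤ ‖cout‖ := by
  obtain ⟨ϖ, hϖ⟩ := exists_isUniformizer (F := K)
  obtain ⟨z, hz, hzn⟩ := LogEnvelope.exists_mem_logUnits_norm_eq_envelope p hϖ hlo hhi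
  have h := hdom z hz
  rwa [hzn, norm_isUniformizer_zpow_eq_rpow p hϖ] at h

include instK in
/-- **abc-iut-c312-5's shell-radius binders are satisfiable at EVERY place** (any `p`, any ramification, ties and `p = 2` included): some
`c_in ≠ 0` with `c_in·𝒪 ⊆ log_p(𝒪^×)` that is maximal (a `w ∉ log_p(𝒪^×)` with `‖w‖·‖ϖ‖ ≤ ‖c_in‖`: the least admissible exponent — the
admissible exponents are bounded below since `log_p(𝒪^×)` is bounded, and `2e` is admissible by abc-iut-S1's `closedBall_subset_logUnits`),
and some `c_out ≠ 0` in `log_p(𝒪^×)` of largest norm (`log_p(𝒪^×)` is compact, abc-iut-S1 `isCompact_logUnits`, and contains `p²`).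
So the U2-LICENCE-WRAPPER's decision is never vacuous. [cite: Mochizuki2012, IUTchIV Prop. 1.2 (i)(ii) p. 10] [cite: NeukirchANT1999, Ch. II (5.5)] -/
theorem exists_shellRadii_witnesses :
    ∃ cin cout : K, cin ≠ 0 ∧ (∀ o : K, ‖o‖ ≤ 1 → cin * o ∈ logUnits K) ∧
      (∃ (ϖ : Kˣ) (w : K), IsUniformizer ϖ ∧ w ∉ logUnits K ∧ ‖w‖ * ‖(ϖ : K)‖ ≤ ‖cin‖) ∧
      cout ≠ 0 ∧ cout ∈ logUnits K ∧ (∀ z ∈ logUnits K, ‖z‖ ≤ ‖cout‖) := by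
  have hp0 : (0 : ℝ) < p := by exact_mod_cast hp.out.pos
  obtain ⟨ϖ, hϖ⟩ := exists_isUniformizer (F := K)
  have hϖ0 : 0 < ‖(ϖ : K)‖ := norm_units_pos ϖ
  have hϖ1 : ‖(ϖ : K)‖ < 1 := hϖ.1
  -- outer witness: the norm attains its maximum on the compact nonempty set `log_p(𝒪^×)`
  obtain ⟨cout, hcout, hmax⟩ := (isCompact_logUnits p K).exists_isMaxOn ⟨0, zero_mem_logUnits (p := p)⟩
    continuous_norm.continuousOn
  have hdom : ∀ z ∈ logUnits K, ‖z‖ ≤ ‖cout‖ := fun z hz => hmax hz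
  -- `p² ∈ log_p(𝒪^×)`, so `cout ≠ 0`
  have hp2mem : ((p : K) ^ 2) ∈ logUnits K := by
    apply closedBall_subset_logUnits p K
    rw [Set.mem_setOf_eq, norm_pow, norm_prime, ← Real.rpow_natCast, ← Real.rpow_neg_one, ← Real.rpow_mul hp0.le]
    norm_num
  have hcout0 : cout ≠ 0 := by
    intro h0
    have h := hdom _ hp2mem
    rw [h0, norm_zero, norm_pow, norm_prime] at h
    exact absurd h (not_le.mpr (by positivity))
  -- inner witness: the least exponent `n` with `{‖z‖ ≤ ‖ϖ‖^n} ⊆ log_p(𝒪^×)`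
  obtain ⟨k₀, hk₀⟩ := hϖ.2 (Units.mk0 cout hcout0)
  rw [Units.val_mk0] at hk₀
  let S : ℤ → Prop := fun n => closedBall (0 : K) (‖(ϖ : K)‖ ^ n) ⊆ logUnits K
  have hSbdd : ∃ b : ℤ, ∀ n : ℤ, S n → b ≤ n := by
    refine ⟨k₀, fun n hn => ?_⟩
    have hmem : (ϖ : K) ^ n ∈ logUnits K := hn (by rw [mem_closedBall_zero_iff, norm_zpow])
    have h := hdom _ hmem
    rw [norm_zpow, hk₀] at h
    exact (zpow_le_zpow_iff_right_of_lt_one₀ hϖ0 hϖ1).mp h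
  have hSinh : ∃ n : ℤ, S n := by
    refine ⟨2 * (absRamificationIdx p K : ℤ), fun z hz => closedBall_subset_logUnits p K ?_⟩
    rw [mem_closedBall_zero_iff] at hz
    rw [Set.mem_setOf_eq]
    refine hz.trans (le_of_eq ?_)
    rw [mul_comm, zpow_mul, zpow_natCast, norm_pow_absRamificationIdx p K hϖ, ← Real.rpow_neg_one,
      ← Real.rpow_intCast, ← Real.rpow_mul hp0.le]
    norm_num
  obtain ⟨n₀, hn₀, hmin⟩ := Int.exists_least_of_bdd hSbdd hSinh
  have hpred : ¬ S (n₀ - 1) := fun h => by have := hmin _ h; omega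
  obtain ⟨w, hw, hwΛ⟩ := Set.not_subset.mp hpred
  rw [mem_closedBall_zero_iff] at hw
  refine ⟨(ϖ : K) ^ n₀, cout, zpow_ne_zero _ ϖ.ne_zero, fun o ho => hn₀ ?_, ⟨ϖ, w, hϖ, hwΛ, ?_⟩, hcout0, hcout, hdom⟩
  · rw [mem_closedBall_zero_iff, norm_mul, norm_zpow]
    exact mul_le_of_le_one_right (zpow_nonneg hϖ0.le _) ho
  · rw [norm_zpow]
    calc ‖w‖ * ‖(ϖ : K)‖ ≤ ‖(ϖ : K)‖ ^ (n₀ - 1) * ‖(ϖ : K)‖ := mul_le_mul_of_nonneg_right hw hϖ0.le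
      _ = ‖(ϖ : K)‖ ^ n₀ := by rw [← zpow_add_one₀ hϖ0.ne', sub_add_cancel]

end Local

/-! ## §2. The integer heart of the inhabited side -/

/-- **The integer heart of the INHABITED side of the U2 cell.** Slots `I` (`|I| = j + 1`), base `p > 1`, ramification `e > 0`; per slot
an inner norm `ρ_in(a) ≤ p^{−R_in/e}` and an outer norm `ρ_out(a) ≥ p^{−R_out/e}`; a different term `d ≥ δ/e`; Θ- and q-norms `p^{−j²P/e}`,
`p^{−P/e}` (Dupuy–Hilado (3.4)). IF **`e·⌊(j²P − j·δ − (j+1)·R_in)/e⌋ + (j+1)·R_out ≤ P`** (`⌊·⌋` = `Int` floor division) THEN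
`∀ m ∈ ℤ, p^m·p^{−j²P/e} ≤ p^{−j·d}·∏_a ρ_in(a) → p^m·p^{−P/e} ≤ ∏_a ρ_out(a)` — the right-hand side of abc-iut-w4-d036's exact cell with
every exact radius replaced by the bound in the monotone direction (the largest admissible `m` is `⌊(j²P − jδ − (j+1)R_in)/e⌋`).
[cite: DupuyHilado2025, §3.4, §4.9, §4.12] [cite: Mochizuki2012, IUTchIV Prop. 1.1 p. 9, Prop. 1.2 (i)(ii) p. 10] -/
theorem cell_rhs_of_bounds {I : Type} [Fintype I] {p : ℕ} (hp : 1 < p) {e : ℕ} (he : 0 < e) {j : ℕ}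
    (hcard : Fintype.card I = j + 1) (P : ℕ) (δ Rin Rout : ℤ) {d : ℝ} (hd : (δ : ℝ) / e ≤ d)
    {ρin ρout : I → ℝ} (hin0 : ∀ a, 0 ≤ ρin a) (hin : ∀ a, ρin a ≤ (p : ℝ) ^ (-((Rin : ℝ) / e)))
    (hout : ∀ a, (p : ℝ) ^ (-((Rout : ℝ) / e)) ≤ ρout a)
    (hcell : (e : ℤ) * ((((j : ℤ) ^ 2 * P - j * δ - (j + 1) * Rin)) / e) + (j + 1) * Rout ≤ P) :
    ∀ m : ℤ, (p : ℝ) ^ m * (p : ℝ) ^ (-((j : ℝ) ^ 2 * P) / e) ≤ (p : ℝ) ^ (-((j : ℝ) * d)) * ∏ a, ρin a →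
      (p : ℝ) ^ m * (p : ℝ) ^ (-(P : ℝ) / e) ≤ ∏ a, ρout a := by
  intro m hm
  have hp0 : (0 : ℝ) < p := by exact_mod_cast (zero_lt_one.trans hp)
  have hp1 : (1 : ℝ) < p := by exact_mod_cast hp
  have he0 : (0 : ℝ) < e := by exact_mod_cast he
  set N : ℤ := (j : ℤ) ^ 2 * P - j * δ - (j + 1) * Rin with hN
  -- (1) the hypothesis forces `m·e ≤ N`
  have hprod_in : ∏ a, ρin a ≤ ((p : ℝ) ^ (-((Rin : ℝ) / e))) ^ (j + 1) := by
    rw [← hcard, ← Finset.card_univ, ← Finset.prod_const]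
    exact Finset.prod_le_prod (fun a _ => hin0 a) fun a _ => hin a
  have h1 : (p : ℝ) ^ m * (p : ℝ) ^ (-((j : ℝ) ^ 2 * P) / e) ≤
      (p : ℝ) ^ (-((j : ℝ) * ((δ : ℝ) / e))) * ((p : ℝ) ^ (-((Rin : ℝ) / e))) ^ (j + 1) := by
    refine hm.trans (mul_le_mul ?_ hprod_in (Finset.prod_nonneg fun a _ => hin0 a) (Real.rpow_nonneg hp0.le _))
    apply Real.rpow_le_rpow_of_exponent_le hp1.le
    have hj : (0 : ℝ) ≤ j := by positivity
    nlinarith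
  have h1' : ((m : ℝ) - ((j : ℝ) ^ 2 * P) / e) ≤ (-((j : ℝ) * δ) - ((j : ℝ) + 1) * Rin) / e := by
    rw [← Real.rpow_intCast, ← Real.rpow_add hp0, ← Real.rpow_mul_natCast hp0.le, ← Real.rpow_add hp0,
      Real.rpow_le_rpow_left_iff hp1] at h1
    have : (-((j : ℝ) * δ) - ((j : ℝ) + 1) * Rin) / e = -((j : ℝ) * ((δ : ℝ) / e)) - ((j : ℝ) + 1) * ((Rin : ℝ) / e) := by
      ring
    rw [this]
    push_cast at h1
    have h' : -((j : ℝ) ^ 2 * P) / (e : ℝ) = -(((j : ℝ) ^ 2 * P) / e) := by ring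
    linarith
  have hme : m * (e : ℤ) ≤ N := by
    have h2 : (m : ℝ) * e - (j : ℝ) ^ 2 * P ≤ -((j : ℝ) * δ) - ((j : ℝ) + 1) * Rin := by
      have := mul_le_mul_of_nonneg_right h1' he0.le
      rwa [sub_mul, div_mul_cancel₀ _ he0.ne', div_mul_cancel₀ _ he0.ne'] at this
    have h3 : ((m * (e : ℤ) : ℤ) : ℝ) ≤ ((N : ℤ) : ℝ) := by
      rw [hN]; push_cast; linarith
    exact_mod_cast h3
  -- (2) hence `m ≤ N / e` and `m·e ≤ P − (j+1)·R_out`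
  have he' : (0 : ℤ) < e := by exact_mod_cast he
  have hmle : m ≤ N / e := Int.le_ediv_of_mul_le he' hme
  have hkey : m * (e : ℤ) - P ≤ -((j : ℤ) + 1) * Rout := by
    have : (e : ℤ) * m ≤ (e : ℤ) * (N / e) := mul_le_mul_of_nonneg_left hmle he'.le
    linarith
  -- (3) back to real powers
  have hprod_out : ((p : ℝ) ^ (-((Rout : ℝ) / e))) ^ (j + 1) ≤ ∏ a, ρout a := by
    rw [← hcard, ← Finset.card_univ, ← Finset.prod_const]
    exact Finset.prod_le_prod (fun a _ => Real.rpow_nonneg hp0.le _) fun a _ => hout a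
  refine le_trans ?_ hprod_out
  rw [← Real.rpow_intCast, ← Real.rpow_add hp0, ← Real.rpow_mul_natCast hp0.le, Real.rpow_le_rpow_left_iff hp1]
  have hkey' : ((m * (e : ℤ) - P : ℤ) : ℝ) ≤ ((-((j : ℤ) + 1) * Rout : ℤ) : ℝ) := by exact_mod_cast hkey
  push_cast at hkey'
  have hkey'' : ((m : ℝ) * e - P) / e ≤ (-((j : ℝ) + 1) * Rout) / e := div_le_div_of_nonneg_right hkey' he0.le
  have eq1 : ((m : ℝ) * e - P) / e = m - (P : ℝ) / e := by rw [sub_div, mul_div_cancel_right₀ _ he0.ne']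
  have eq2 : (-((j : ℝ) + 1) * Rout) / e = -((j : ℝ) + 1) * ((Rout : ℝ) / e) := by ring
  rw [eq1, eq2] at hkey''
  push_cast
  have h' : -(P : ℝ) / (e : ℝ) = -((P : ℝ) / e) := by ring
  linarith

end Literature.IUT.LogVolume

end
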